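import Summits.QuantumFields.BalabanUV.T4Continuum.Support.NE9StateLinftyEquiv
import Summits.QuantumFields.BalabanUV.T4Continuum.Support.NE9FutureProfileEnd

/-!
# NE9FutureProfileEndSP — ROUTE R4♯ «POLYDISC SCHWARZ–PICK» DOCKED AT K2♭: the END of `NE9FutureProfileEnd` in
# future-influence coordinates with its binders (B1)–(B4) + room VERBATIM, conclusion at the SHARP rate `θ` with constant
# `cY·(1∕(1−θ²))·(τ₀ℓ)` — by the tree's polydisc chain `NE9PolydiscChain.chainLipschitz_of_holoSelfMaps_polydisc` and the
# docking isometry `NE9StateLinftyEquiv.stateLinftyEquiv`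
# (cell `pub-balaban`, T4-DAG §6 NE9, route R4♯ of `t4/ROUTES-NE9.md` v5 §V5 ∕ v6 §V6 — the planner's OFFER (b) «→ leaf-04
# (K2♭ holder)»; OWNER `b2b-balaban-t4-ne9-p1` gen 60 word «leaf-04: GO» CLAIMS.log 2026-08-21T07:39:41Z; unit
# `b2b-balaban-t4-ne9-formalise-leaf-04` gen 47, pre-build F-ne9leaf04g46-1 (gen 46, HOME
# `t4/b2b-balaban-t4-ne9-formalise-leaf-04/g46/sp/`); imports the two named modules ONLY; modifies nothing; 0 def outside the
# §3 toy; 0 `def … : Prop`; 0 sorry)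

HONEST FRAMING (T4-DAG PAGE 1).  Rung (B)+1 of the FINITE-VOLUME T⁴ programme — NOT infinite volume, NOT a mass gap, NOT the
Clay problem.  NE9 (`T4OutputRate.NE9` ∧ `FadingMemory`) is a cell NEW ESTIMATE, NOT PRINTED in [I] = [Balaban1987RG1] (CMP 109),
[II] = [Balaban1988RG2Cluster] (CMP 116), and NOT PROVED for Bałaban's E^{(j)} («NE9 ⇐ the named binders»; spine PROVED 0∕9; row NE9
WALLED ON A MODEL, O-NE9-1).  HONEST DEPENDENCY (cell line, verbatim): continuum YM on T⁴ ⇐ BetaPertH ∧ nine spine estimates (0/9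
proved); BetaPertH ⇐ (D1) ∧ (D4) ∧ CAP+tail; G-an2-4 gates asym, D1 and NE2/3/4.  `FlowStep.BetaPertH`, (B), (B^μ) do not occur.
This file is GENERIC complex-Banach bookkeeping: it constructs NO object of Bałaban's and discharges NO Bałaban-side hypothesis;
nothing printed is asserted (ABSOLUTE RULE); no `def … : Prop` hypothesis is minted; a sharper constant inside a CONDITIONAL END
is not progress on the estimate itself.

WHAT THIS FILE DOES.
* §1 `ne9_and_fadingMemory_futureInfluence_polydisc`: the binders of K2♭'s `NE9FutureProfileEnd.ne9_and_fadingMemory_futureInfluence_EH`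
  VERBATIM and in the same order — (B1) Fréchet holomorphy AND size `B₀` of the new-slice maps `Φ k (g k)` on the `r`-ball of
  tables, (B2) `‖J k‖ ≤ τ₀`, the room N2♭ `ω̂·r + τ₀·B₀ ≤ θ·r` (`0 < θ < 1`), a common initial state in the `θr`-ball, (B3) the
  𝔜-level last-coupling pair (`lam k ≤ ℓ`), (B4) the weighted coordinate read-out — PLUS ONE structural datum, a polydisc
  structure `e : 𝔜 × Fut W Pot ≃ₗᵢ[ℂ] ℓ^∞(A;ℂ)` on the state space, give
  `NE9 E W κ (prodModuli (cY·(1∕(1−θ²))·(τ₀ℓ)) (fun _ => θ)) ∧ FadingMemory (cY·(1∕(1−θ²))·(τ₀ℓ)∕θ) θ (…)` — rate `θ` instead of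
  the Earle–Hamilton `2θ∕(1+θ)`, prefactor `1∕(1−θ²)` instead of `2∕(1−θ)`.  ONE term: K2♭'s generic END
  `ne9_and_fadingMemory_futureInfluence` (ANY chain estimate) ∘ `NE9PolydiscChain.chainLipschitz_of_holoSelfMaps_polydisc e` ∘
  `NE9FutureProfileStep.holoSelfMaps_step`.
* §2 `ne9_and_fadingMemory_futureInfluence_SP`: the DROP-IN form (no `e` argument) on slices `𝔜 := ℓ^∞(B₁;ℂ)` and tables
  `Pot := ℓ^∞(ι;ℂ)`, `e := stateLinftyEquiv B₁ (Idx W) ι`.  With `B₁ := Bg × C.Dom` these are EXACTLY the spaces on which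
  `NE9FutureProfileEndOfRecord.ne9_and_fadingMemory_of_holoSlice` docks at `…_futureInfluence_EH` (its `key` step): that END — and
  any END docking there — reads rate `θ`, constant `(1∕(1−θ²))·ℓ` by swapping ONE lemma name (same hypotheses, same order).
  Arithmetic `example` at the room's print-letter READING (`ω̂ = 1∕13`, `τ₀B₀∕r = ½` ⇒ `θ = 15∕26`, prefactor `676∕451`; vs
  `30∕41`, `52∕11`) — a reading of [II] p. 8, asserted of nothing.
* §3 NON-VACUITY OF THE DROP-IN END on the `ℓ^∞` spaces themselves: an affine toy `Φ k s P := (s + P(⋆)∕4)_⋆` on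
  `𝔜 = Pot = ℓ^∞(Unit;ℂ)` (the packing `NE9EllInftyHolomorphy.pack` of one coordinate function), `J = 0`, window `]0, 1∕8]`: (B1)
  by `differentiableOn_pack` ∕ `mapsTo_pack_closedBall`, (B2)–(B4) and the room `θ = 19∕32` discharged, and `…_SP` FIRES
  (`NE9 ∧ FadingMemory` at rate `19∕32 < 1`).  (A toy with `J ≠ 0` and an `s`-dependent reading for the `…_EH` form is the gen-46
  HOME certificate `g46/toy/CERT-LiveToy.md`; not repeated here.)
«NE9 ⇐ the named binders»: (B1)–(B4) are DISPLAYED; nothing of Bałaban's is discharged here.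

References (TYPES ∕ loci only): [EH1970] C. J. Earle, R. S. Hamilton, Proc. Sympos. Pure Math. XVI (1970) 61–65; [FV1980]
T. Franzoni, E. Vesentini, *Holomorphic maps and invariant distances*, North-Holland Math. Studies 40 (1980) ch. V §5;
[Balaban1988RG2Cluster] CMP **116** (1988) pp. 7–9 (1.23)–(1.36), p. 8 l. 9–10; [Balaban1987RG1] CMP **109** (1987) p. 263.
Summits-side NEW work (LEAN PLACEMENT RULE).
-/

noncomputable section

namespace Summit.QuantumFields.BalabanUV.T4Continuum.NE9FutureProfileEndSP

open Metric Set
open scoped ENNReal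
open Literature.MathematicalPhysics.QuantumFieldTheory.Balaban1983to89.T4OutputRate
open Literature.MathematicalPhysics.QuantumFieldTheory.Balaban1983to89.T4HistoryLipschitzRecursion (prodModuli)
open Summit.QuantumFields.BalabanUV.T4Continuum.NE9EarleHamiltonChain
open Summit.QuantumFields.BalabanUV.T4Continuum.NE9FutureProfileStep
open Summit.QuantumFields.BalabanUV.T4Continuum.NE9FutureProfileEnd (ne9_and_fadingMemory_futureInfluence)
open Summit.QuantumFields.BalabanUV.T4Continuum.NE9PolydiscChain (chainLipschitz_of_holoSelfMaps_polydisc)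
open Summit.QuantumFields.BalabanUV.T4Continuum.NE9StateLinftyEquiv (stateLinftyEquiv)

variable {𝔜 Pot : Type*} [NormedAddCommGroup 𝔜] [NormedSpace ℂ 𝔜] [NormedAddCommGroup Pot] [NormedSpace ℂ Pot]
variable {W : Set (ℕ → ℝ)} {Φ : ℕ → ℝ → Pot → 𝔜} {J : ℕ → (𝔜 →L[ℂ] Fut W Pot)} {τ₀ ωh : ℝ}

/-! ## §1 THE END OF ROUTE R4♯ IN FUTURE-INFLUENCE COORDINATES — polydisc form (one structural datum `e`) -/

/-- **ROUTE R4♯'s END IN FUTURE-INFLUENCE COORDINATES — POLYDISC FORM.**  The binders of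
`NE9FutureProfileEnd.ne9_and_fadingMemory_futureInfluence_EH` VERBATIM and in the same order ((B1) Fréchet holomorphy + size
`B₀` of `Φ k (g k)` on the `r`-ball of tables, (B2) `‖J k‖ ≤ τ₀`, the room N2♭ `ω̂·r + τ₀·B₀ ≤ θ·r` with `0 < θ < 1`, a common
initial state in the `θr`-ball, (B3) the 𝔜-level last-coupling pair with `lam k ≤ ℓ`, (B4) the weighted coordinate read-out)
PLUS ONE structural datum — a polydisc structure `e : 𝔜 × Fut W Pot ≃ₗᵢ[ℂ] ℓ^∞(A;ℂ)` on the state space — give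
`NE9 ∧ FadingMemory` at the SHARP rate `θ` with constant `cY·(1∕(1−θ²))·(τ₀ℓ)` (the Earle–Hamilton form `…_EH` gives rate
`2θ∕(1+θ)` and constant `cY·(2∕(1−θ))·(τ₀ℓ)`).  Proof = ONE term: K2♭'s generic END `ne9_and_fadingMemory_futureInfluence`
(which accepts ANY chain estimate) fed by the polydisc Schwarz–Pick chain
`NE9PolydiscChain.chainLipschitz_of_holoSelfMaps_polydisc e` on K2♭'s instance `NE9FutureProfileStep.holoSelfMaps_step`.
HONEST: hypotheses → `NE9 ∧ FadingMemory`; (B1)–(B4) are DISPLAYED, discharged of nothing here; NE9 NOT PRINTED ∕ NOT PROVED.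
[folklore] -/
theorem ne9_and_fadingMemory_futureInfluence_polydisc {A : Type*} (e : (𝔜 × Fut W Pot) ≃ₗᵢ[ℂ] lp (fun _ : A => ℂ) ∞)
    {C : Carriers} {Bg : Type} (E : Functional C Bg) (e₀ : 𝔜 × Fut W Pot)
    (coord : Bg → C.Dom → (𝔜 →L[ℂ] ℂ)) {κ cY r B₀ θ ℓ : ℝ} {lam : ℕ → ℝ}
    (hr : 0 < r) (hθ0 : 0 < θ) (hθ1 : θ < 1) (hℓ : 0 ≤ ℓ) (hcY : 0 ≤ cY) (hτ₀ : 0 ≤ τ₀) (hωh : 0 ≤ ωh)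
    (hΦd : ∀ k, ∀ g ∈ W, DifferentiableOn ℂ (Φ k (g k)) (ball (0 : Pot) r))
    (hΦb : ∀ k, ∀ g ∈ W, MapsTo (Φ k (g k)) (ball (0 : Pot) r) (closedBall 0 B₀))
    (hJ : ∀ k, ‖J k‖ ≤ τ₀) (hθ : ωh * r + τ₀ * B₀ ≤ θ * r) (he₀ : ‖e₀‖ ≤ θ * r)
    (hΦlast : ∀ k, ∀ g (hg : g ∈ W), ∀ g' (hg' : g' ∈ W),
      ‖Φ k (g k) ((emb W Φ J τ₀ ωh e₀ k g).2 ⟨0, ⟨g, hg⟩⟩) -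
          Φ k (g' k) ((emb W Φ J τ₀ ωh e₀ k g).2 ⟨0, ⟨g', hg'⟩⟩)‖ ≤ lam k * |g k - g' k|)
    (hlam : ∀ k, lam k ≤ ℓ)
    (hcoord : ∀ U X, ‖coord U X‖ ≤ cY * Real.exp (-(κ * C.d X)))
    (hE : ∀ g ∈ W, ∀ (U : Bg) (X : C.Dom), E g U X = (coord U X (emb W Φ J τ₀ ωh e₀ (C.scale X) g).1).re) :
    NE9 E W κ (prodModuli (cY * (1 / (1 - θ ^ 2)) * (τ₀ * ℓ)) fun _ => θ) ∧
      FadingMemory (cY * (1 / (1 - θ ^ 2)) * (τ₀ * ℓ) / θ) θ (prodModuli (cY * (1 / (1 - θ ^ 2)) * (τ₀ * ℓ)) fun _ => θ) :=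
  ne9_and_fadingMemory_futureInfluence E e₀ coord hr hθ1 (one_div_nonneg.2 (by nlinarith)) hθ0 hℓ hcY hτ₀ hωh hΦb hJ hθ he₀
    (chainLipschitz_of_holoSelfMaps_polydisc e hr hθ0 hθ1 (holoSelfMaps_step hτ₀ hωh hΦd hΦb hJ hθ)) hΦlast hlam hcoord hE

/-! ## §2 Drop-in form on the record's spaces `𝔜 := ℓ^∞(B₁;ℂ)`, `Pot := ℓ^∞(ι;ℂ)` (no `e` argument) -/

/-- **ROUTE R4♯'s END, DROP-IN FORM ON THE RECORD'S SPACES** (no `e` argument): slices `𝔜 := ℓ^∞(B₁;ℂ)` (with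
`B₁ := Bg × C.Dom` this is the AMBIENT slice space `lp (fun _ : Bg × C.Dom => ℂ) ∞` of `NE9FutureProfileRecordPrelim` ∕
`NE9FutureProfileEndOfRecord`) and tables `Pot := ℓ^∞(ι;ℂ)` — the state space `𝔜 × Fut W Pot` IS the polydisc space
`ℓ^∞(B₁ ⊕ Idx W × ι;ℂ)` via `NE9StateLinftyEquiv.stateLinftyEquiv B₁ (Idx W) ι`; binders = `…_futureInfluence_EH`'s VERBATIM and
in the same order; conclusion at rate `θ` with constant `cY·(1∕(1−θ²))·(τ₀ℓ)`.  So any END that docks at `…_futureInfluence_EH`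
(e.g. `NE9FutureProfileEndOfRecord.ne9_and_fadingMemory_of_holoSlice`, whose `key` step is that lemma with `cY := τ₀⁻¹`) reads
`prodModuli ((1∕(1−θ²))·ℓ) (fun _ => θ)` by swapping the ONE lemma name (and `2∕(1−θ) ↦ 1∕(1−θ²)` in its constant
identity).  HONEST: hypotheses → `NE9 ∧ FadingMemory`; NE9 NOT PRINTED ∕ NOT PROVED; spine 0∕9. [folklore] -/
theorem ne9_and_fadingMemory_futureInfluence_SP {B₁ ι : Type*} {W : Set (ℕ → ℝ)}
    {Φ : ℕ → ℝ → lp (fun _ : ι => ℂ) ∞ → lp (fun _ : B₁ => ℂ) ∞}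
    {J : ℕ → (lp (fun _ : B₁ => ℂ) ∞ →L[ℂ] Fut W (lp (fun _ : ι => ℂ) ∞))} {τ₀ ωh : ℝ}
    {C : Carriers} {Bg : Type} (E : Functional C Bg) (e₀ : lp (fun _ : B₁ => ℂ) ∞ × Fut W (lp (fun _ : ι => ℂ) ∞))
    (coord : Bg → C.Dom → (lp (fun _ : B₁ => ℂ) ∞ →L[ℂ] ℂ)) {κ cY r B₀ θ ℓ : ℝ} {lam : ℕ → ℝ}
    (hr : 0 < r) (hθ0 : 0 < θ) (hθ1 : θ < 1) (hℓ : 0 ≤ ℓ) (hcY : 0 ≤ cY) (hτ₀ : 0 ≤ τ₀) (hωh : 0 ≤ ωh)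
    (hΦd : ∀ k, ∀ g ∈ W, DifferentiableOn ℂ (Φ k (g k)) (ball (0 : lp (fun _ : ι => ℂ) ∞) r))
    (hΦb : ∀ k, ∀ g ∈ W, MapsTo (Φ k (g k)) (ball (0 : lp (fun _ : ι => ℂ) ∞) r) (closedBall 0 B₀))
    (hJ : ∀ k, ‖J k‖ ≤ τ₀) (hθ : ωh * r + τ₀ * B₀ ≤ θ * r) (he₀ : ‖e₀‖ ≤ θ * r)
    (hΦlast : ∀ k, ∀ g (hg : g ∈ W), ∀ g' (hg' : g' ∈ W),
      ‖Φ k (g k) ((emb W Φ J τ₀ ωh e₀ k g).2 ⟨0, ⟨g, hg⟩⟩) -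
          Φ k (g' k) ((emb W Φ J τ₀ ωh e₀ k g).2 ⟨0, ⟨g', hg'⟩⟩)‖ ≤ lam k * |g k - g' k|)
    (hlam : ∀ k, lam k ≤ ℓ)
    (hcoord : ∀ U X, ‖coord U X‖ ≤ cY * Real.exp (-(κ * C.d X)))
    (hE : ∀ g ∈ W, ∀ (U : Bg) (X : C.Dom), E g U X = (coord U X (emb W Φ J τ₀ ωh e₀ (C.scale X) g).1).re) :
    NE9 E W κ (prodModuli (cY * (1 / (1 - θ ^ 2)) * (τ₀ * ℓ)) fun _ => θ) ∧
      FadingMemory (cY * (1 / (1 - θ ^ 2)) * (τ₀ * ℓ) / θ) θ (prodModuli (cY * (1 / (1 - θ ^ 2)) * (τ₀ * ℓ)) fun _ => θ) :=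
  ne9_and_fadingMemory_futureInfluence_polydisc (stateLinftyEquiv B₁ (Idx W) ι) E e₀ coord hr hθ0 hθ1 hℓ hcY hτ₀ hωh hΦd
    hΦb hJ hθ he₀ hΦlast hlam hcoord hE

/-- ARITHMETIC AT THE ROOM N2♭'s print letters (ROUTES-NE9 v3 §L1.0: `ω̂ = 1∕13`, `τ₀B₀∕r = ½` ⇒ `θ = 15∕26`): rate `15∕26 ≈
0.577` (vs `30∕41 ≈ 0.732`), prefactor `676∕451 ≈ 1.50` (vs `52∕11 ≈ 4.73`).  A READING of [II] p. 8 l. 9–10, asserted of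
nothing. [folklore] -/
example : (1 : ℝ) / 13 * 1 + 1 / 2 = 15 / 26 * 1 ∧ (1 : ℝ) / (1 - (15 / 26) ^ 2) = 676 / 451 ∧
    2 * ((15 : ℝ) / 26) / (1 + 15 / 26) = 30 / 41 ∧ (15 : ℝ) / 26 < 30 / 41 ∧ (676 : ℝ) / 451 < 52 / 11 := by norm_num

/-! ## §3 NON-VACUITY OF THE DROP-IN END: an affine toy on `ℓ^∞(Unit;ℂ)` on which (B1)–(B4) hold and `…_SP` FIRES (rate 19∕32) -/

section Toy

open Literature.MathematicalPhysics.QuantumFieldTheory.Balaban1983to89.T4HistoryLipschitzRecursion (toyCarriers)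
open Summit.QuantumFields.BalabanUV.T4Continuum.NE9EllInftyHolomorphy (pack pack_apply_of_bound mapsTo_pack_closedBall
  differentiableOn_pack)

/-- `ℓ^∞` over ONE point — the smallest instance of the record's table ∕ slice spaces `lp (fun _ : ι => ℂ) ∞`. [folklore] -/
abbrev L1 : Type := lp (fun _ : Unit => ℂ) ∞

/-- The coordinate of `ℓ^∞(Unit;ℂ)` (Mathlib's evaluation CLM). [folklore] -/
abbrev ev : L1 →L[ℂ] ℂ := lp.evalCLM ℂ (fun _ : Unit => ℂ) ∞ ()

/-- TOY new-slice map on `𝔜 = Pot = ℓ^∞(Unit;ℂ)`: `Φ k s P := (s + P(⋆)∕4)_⋆` — the `ℓ^∞`-packing (`NE9EllInftyHolomorphy.pack`)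
of ONE affine coordinate function. [folklore] -/
def toyΦ : ℕ → ℝ → L1 → L1 := fun _ s => pack fun (_ : Unit) (P : L1) => (s : ℂ) + (1 / 4 : ℂ) * ev P

/-- TOY orbit: window `]0, 1∕8]`, no injection (`J = 0`), `τ₀ = 1∕4`, `ωh = 1∕2`, initial state `0`. [folklore] -/
abbrev toyEmb : ℕ → (ℕ → ℝ) → L1 × Fut (Window (1 / 8)) L1 :=
  emb (Window (1 / 8)) toyΦ (fun _ => 0) (1 / 4) (1 / 2) 0

/-- TOY functional on `toyCarriers`: the real part of the `⋆`-coordinate of the slice coordinate of the orbit (so (B4) holds by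
`rfl` with `coord := ev`). [folklore] -/
def toyFun : Functional toyCarriers Unit := fun g _ X => (ev (toyEmb X g).1).re

/-- The toy slice map, coordinatewise. [folklore] -/
theorem toyΦ_apply (k : ℕ) (s : ℝ) (P : L1) : (toyΦ k s P : Unit → ℂ) () = (s : ℂ) + (1 / 4 : ℂ) * ev P :=
  pack_apply_of_bound (M := ‖(s : ℂ) + (1 / 4 : ℂ) * ev P‖) (fun _ => le_rfl) ()

/-- With no injection the profile coordinate of the toy orbit vanishes identically. [folklore] -/
theorem toyEmb_snd (k : ℕ) {g : ℕ → ℝ} (hg : g ∈ Window (1 / 8)) : (toyEmb k g).2 = 0 := by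
  induction k with
  | zero => rfl
  | succ k ih =>
    show (step (Window (1 / 8)) toyΦ (fun _ => 0) (1 / 4) (1 / 2) k g (toyEmb k g)).2 = 0
    rw [step_of_mem hg]
    show ((1 / 2 : ℝ) : ℂ) • shift (Window (1 / 8)) (toyEmb k g).2 +
        (0 : L1 →L[ℂ] Fut (Window (1 / 8)) L1) (toyΦ k (g k) ((toyEmb k g).2 ⟨0, ⟨g, hg⟩⟩)) = 0
    rw [ih, map_zero, smul_zero, zero_add]
    rfl

/-- **NON-VACUITY OF THE DROP-IN END.**  On the toy, (B1)–(B4), the room (`θ = 19∕32`) and the initial state are ALL discharged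
on the `ℓ^∞` spaces themselves and `ne9_and_fadingMemory_futureInfluence_SP` yields `NE9 ∧ FadingMemory` at the rate `19∕32 < 1`
with constant `1·(1∕(1−(19∕32)²))·(¼·1)` — the binders are jointly satisfiable and the ♯-END fires. [folklore] -/
example : ∃ (Λ : ℕ → ℕ → ℝ) (C₉ ω : ℝ), NE9 toyFun (Window (1 / 8)) 0 Λ ∧ FadingMemory C₉ ω Λ ∧ ω < 1 := by
  have hW : ∀ g ∈ Window (1 / 8), ∀ k, |g k| ≤ 1 / 8 := fun g hg k => by
    rw [abs_of_pos (mem_window.mp hg k).1]; exact (mem_window.mp hg k).2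
  have hev : ∀ P : L1, ‖ev P‖ ≤ ‖P‖ := fun P => lp.norm_apply_le_norm ENNReal.top_ne_zero P ()
  have hbd : ∀ k, ∀ g ∈ Window (1 / 8), ∀ P ∈ ball (0 : L1) 1, ‖(g k : ℂ) + (1 / 4 : ℂ) * ev P‖ ≤ 3 / 8 := by
    intro k g hg P hP
    rw [mem_ball_zero_iff] at hP
    calc ‖(g k : ℂ) + (1 / 4 : ℂ) * ev P‖ ≤ ‖(g k : ℂ)‖ + ‖(1 / 4 : ℂ) * ev P‖ := norm_add_le _ _
      _ = |g k| + 1 / 4 * ‖ev P‖ := by rw [Complex.norm_real, Real.norm_eq_abs, norm_mul]; norm_num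
      _ ≤ 1 / 8 + 1 / 4 * 1 := add_le_add (hW g hg k) (by gcongr; exact (hev P).trans hP.le)
      _ = 3 / 8 := by norm_num
  have h := ne9_and_fadingMemory_futureInfluence_SP (B₁ := Unit) (ι := Unit) (W := Window (1 / 8)) (Φ := toyΦ)
    (J := fun _ => 0) (τ₀ := 1 / 4) (ωh := 1 / 2) toyFun 0 (fun _ _ => ev)
    (κ := 0) (cY := 1) (r := 1) (B₀ := 3 / 8) (θ := 19 / 32) (ℓ := 1) (lam := fun _ => 1)
    (by norm_num) (by norm_num) (by norm_num) (by norm_num) (by norm_num) (by norm_num) (by norm_num)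
    (fun k g hg => differentiableOn_pack (M := 3 / 8) isOpen_ball
      (fun _ => ((differentiable_const _).add ((differentiable_const _).mul ev.differentiable)).differentiableOn)
      (fun _ P hP => hbd k g hg P hP))
    (fun k g hg => mapsTo_pack_closedBall (by norm_num) (fun _ P hP => hbd k g hg P hP))
    (fun _ => by rw [norm_zero]; norm_num) (by norm_num) (by rw [norm_zero]; norm_num)
    (fun k g hg g' hg' => by
      simp only [toyEmb_snd k hg, BoundedContinuousFunction.coe_zero, Pi.zero_apply, one_mul]
      refine lp.norm_le_of_forall_le (abs_nonneg _) fun u => ?_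
      obtain ⟨⟩ := u
      rw [lp.coeFn_sub, Pi.sub_apply, toyΦ_apply, toyΦ_apply, map_zero, mul_zero, add_zero, add_zero,
        ← Complex.ofReal_sub, Complex.norm_real, Real.norm_eq_abs])
    (fun _ => le_rfl)
    (fun _ _ => by
      rw [Real.exp_eq_one_iff _ |>.mpr (by simp), mul_one]
      exact ContinuousLinearMap.opNorm_le_bound _ zero_le_one fun P => by rw [one_mul]; exact hev P)
    (fun _ _ _ _ => rfl)
  exact ⟨_, _, _, h.1, h.2, by norm_num⟩

end Toy

end Summit.QuantumFields.BalabanUV.T4Continuum.NE9FutureProfileEndSP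

end
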